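import Summits.KontsevichZagierPeriods.KontsevichZagierPeriods.Theorems.SymplecticScissorsRealOnePeriodRelationsStubFormReductionPAux2

/-!
# Crux `RealOnePeriodRelations` (stmt-KontsevichZagierPeriods-10042), line `nash-retraction-thin-strip`, reshape 10:
# de Rham reduction on `C_T` (stub `stub_formReductionP`), III: lowering the order of the pole at `x = a ∈ T`

Third of five files proving `stub_formReductionP`.  With `u = invX T a` (`= 1/(x − a)` on `C_T`, `a ∈ T`):
`d(u^{i+1}) ≡ −(i+1) u^{i+2} dx` (`eval_Rpol`, `fred_invX_pow_dx`) and
`d(y u^j) ≡ [−j f(a) u^{j+1} + (½ − j) f′(a) u^j − 3a(j − 1) u^{j−1} − (j − 3/2) u^{j−2}] θ₀^C`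
(`fred_pole_one`, `fred_pole_succ`: rules (a), (b), (w) and the Taylor expansion of `f`, `f′` at `a`), whence
`u^m θ₀^C` is reducible for all `m` by strong induction, dividing by `−j f(a)` or, at a `2`-torsion abscissa
(`f(a) = 0`, `f′(a) ≠ 0`), by `(½ − j) f′(a)` (`fred_invX_pow_smul_Theta0`).
[cite: HuberWustholz2022, §3.3.1, §13.2]
-/

noncomputable section

open scoped BigOperators Topology PeriodPair
open Set Filter MvPolynomial Complex
open Literature.NumberTheory.Transcendental Literature.NumberTheory.Transcendental.CurvePeriods
open Literature.NumberTheory.Transcendental.CurvePeriods.Ell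

namespace Summit.KontsevichZagierPeriods.SymplecticScissors.RealOnePeriodRelations

namespace TorsionLayer

variable {L : PeriodPair} {T : Finset ℂ}

set_option quotPrecheck false in
/-- `FRed[L, T] ω`: the polynomial 1-form `ω` on `C_T` is `a θ₀ + b θ₁ + Σ e_t dx/(x − t) + Σ o_t ξ_t + dF + ν`
with algebraic data and `ν` over `ℚ̄` vanishing on `C_T` (the conclusion of `stub_formReductionP`). -/
local notation3 (prettyPrint := false) "FRed[" L' ", " T' "] " ω:arg =>
  (∃ (a b : ℂ) (e o : ℂ → ℂ) (F : MvPolynomial (Fin 3) ℂ) (ν : Fin 3 → MvPolynomial (Fin 3) ℂ),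
    IsAlgebraic ℚ a ∧ IsAlgebraic ℚ b ∧ (∀ t ∈ T', IsAlgebraic ℚ (e t)) ∧ (∀ t ∈ T', IsAlgebraic ℚ (o t)) ∧
    HasAlgCoeffs F ∧ (∀ i, HasAlgCoeffs (ν i)) ∧ VanishesOn (curveP L' T') ν ∧
    ω = a • Theta0 L' + b • Theta1 L' + ∑ t ∈ T', e t • dlogV T' t + ∑ t ∈ T', o t • Xi L' T' t + formD F + ν)

/-! ## Pole lowering at `x = a`, `a ∈ T` -/

section Pole

variable {a : ℂ}

/-- `∏_{b∈T}(x − b) = (x − a) ∏_{b ≠ a}(x − b)` for `a ∈ T`. [folklore] -/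
theorem prodP_eq_mul (ha : a ∈ T) : prodP T = (X 0 - C a) * cofP T a := by
  classical
  rw [prodP, cofP]
  exact (Finset.mul_prod_erase T (fun b => (X 0 : MvPolynomial (Fin 3) ℂ) - C b) ha).symm

variable (T a) in
/-- `∂_y`, `∂_w` kill `∏_{b≠a}(x − b)`. [folklore] -/
theorem pderiv_cofP_of_ne_zero {i : Fin 3} (hi : i ≠ 0) : pderiv i (cofP T a) = 0 := by
  rw [cofP]
  refine Finset.prod_induction _ (fun F : MvPolynomial (Fin 3) ℂ => pderiv i F = 0)
    (fun F G hF hG => ?_) (by simp) (fun b _ => ?_)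
  · rw [Derivation.leibniz, hF, hG, smul_zero, smul_zero, add_zero]
  · simp [pderiv_X, hi.symm]

/-- `∂ₓ ∏ = ∏_{b≠a} + (x − a) ∂ₓ ∏_{b≠a}` at a point. [folklore] -/
theorem eval_pderiv_zero_prodP (ha : a ∈ T) (p : Fin 3 → ℂ) :
    eval p (pderiv 0 (prodP T)) = eval p (cofP T a) + (p 0 - a) * eval p (pderiv 0 (cofP T a)) := by
  rw [prodP_eq_mul ha, pderiv_mul]
  simp [pderiv_X]

/-- `∏ (p₀ − b) = (p₀ − a) · cof(p)`. [folklore] -/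
theorem prod_eq_mul_eval_cofP (ha : a ∈ T) (p : Fin 3 → ℂ) :
    ∏ b ∈ T, (p 0 - b) = (p 0 - a) * eval p (cofP T a) := by
  have h := congrArg (eval p) (prodP_eq_mul (T := T) ha)
  rw [eval_prodP] at h
  simpa using h

variable (T a) in
/-- `invX = w · cof`. [folklore] -/
theorem eval_invX (p : Fin 3 → ℂ) : eval p (invX T a) = p 2 * eval p (cofP T a) := by
  simp [invX]

/-- On `C_T`: `w (p₀ − a) cof(p) = 1`. [folklore] -/
theorem w_mul_eq_one (ha : a ∈ T) {p : Fin 3 → ℂ} (hp : p ∈ (curveP L T).points) :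
    p 2 * ((p 0 - a) * eval p (cofP T a)) = 1 := by
  rw [← prod_eq_mul_eval_cofP ha]
  exact ((mem_points_curveP_iff L T p).1 hp).2

/-- On `C_T`: `invX(p) · (p₀ − a) = 1` (`invX T a` is `1/(x − a)`). [folklore] -/
theorem eval_invX_mul_sub (ha : a ∈ T) {p : Fin 3 → ℂ} (hp : p ∈ (curveP L T).points) :
    eval p (invX T a) * (p 0 - a) = 1 := by
  rw [eval_invX]
  linear_combination w_mul_eq_one ha hp

variable (T a) in
/-- [folklore] -/
theorem pderiv_one_invX : pderiv 1 (invX T a) = 0 := by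
  rw [invX, pderiv_mul, pderiv_cofP_of_ne_zero T a (i := 1) (by decide)]
  simp [pderiv_X]

variable (T a) in
/-- [folklore] -/
theorem pderiv_zero_invX : pderiv 0 (invX T a) = X 2 * pderiv 0 (cofP T a) := by
  rw [invX, pderiv_mul]
  simp [pderiv_X]

variable (T a) in
/-- [folklore] -/
theorem pderiv_two_invX : pderiv 2 (invX T a) = cofP T a := by
  rw [invX, pderiv_mul, pderiv_cofP_of_ne_zero T a (i := 2) (by decide)]
  simp [pderiv_X]

/-- **`R_{a,i}(p) = −(i+1) u(p)^{i+2}` on `C_T`**, where `R_{a,i} = ∂ₓ(u^{i+1}) − ∂_w(u^{i+1}) w² ∂ₓ∏` is the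
`dx`-coefficient of `d(u^{i+1})` after eliminating `dw` (`u = invX T a = 1/(x − a)`: `du = −u² dx`). [folklore] -/
theorem eval_Rpol (ha : a ∈ T) {p : Fin 3 → ℂ} (hp : p ∈ (curveP L T).points) (i : ℕ) :
    eval p (pderiv 0 (invX T a ^ (i + 1)) - pderiv 2 (invX T a ^ (i + 1)) * X 2 ^ 2 * pderiv 0 (prodP T)) =
      -((i : ℂ) + 1) * eval p (invX T a) ^ (i + 2) := by
  have hw := w_mul_eq_one ha hp
  rw [map_sub, map_mul, map_mul, pderiv_pow, pderiv_pow, Nat.add_sub_cancel, pderiv_zero_invX, pderiv_two_invX,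
    eval_pderiv_zero_prodP ha]
  simp only [map_mul, map_add, map_one, map_natCast, map_pow, eval_X, Nat.cast_add, Nat.cast_one, eval_invX]
  linear_combination
    (-(((i : ℂ) + 1) * (p 2 * eval p (cofP T a)) ^ i * p 2 * eval p (pderiv 0 (cofP T a)))) * hw

/-- `∂_y (u^{i+1}) = 0`. [folklore] -/
theorem pderiv_one_invX_pow (i : ℕ) : pderiv 1 (invX T a ^ (i + 1)) = 0 := by
  rw [pderiv_pow, pderiv_one_invX, mul_zero]

/-- `d(u^{i+1}) = R_{a,i} dx + (∂_w u^{i+1}) (w² ∂ₓ∏ dx + dw)`. [folklore] -/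
theorem formD_invX_pow (i : ℕ) :
    formD (invX T a ^ (i + 1)) =
      (![(pderiv 0 (invX T a ^ (i + 1)) - pderiv 2 (invX T a ^ (i + 1)) * X 2 ^ 2 * pderiv 0 (prodP T)), 0, 0] : Fin 3 → MvPolynomial (Fin 3) ℂ) + ![pderiv 2 (invX T a ^ (i + 1)) * X 2 ^ 2 * pderiv 0 (prodP T), 0, pderiv 2 (invX T a ^ (i + 1))] := by
  rw [funext_iff, Fin.forall_fin_succ, Fin.forall_fin_two, Fin.succ_zero_eq_one, Fin.succ_one_eq_two]
  simp only [formD, Pi.add_apply, Matrix.cons_val_zero, Matrix.cons_val_one, Matrix.cons_val_two,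
    Matrix.head_cons, Matrix.tail_cons, pderiv_one_invX_pow, add_zero]
  exact ⟨by ring, trivial, by ring⟩

/-- **`d(y u^{i+1})` on `C_T`**: `d(y u^{i+1}) = (R_{a,i} f + u^{i+1} f′/2) θ₀^C + ν` with `ν` the sum of the three
basic vanishing forms (rules (a), (b), (w)). [folklore] -/
theorem formD_X_one_mul_invX_pow (i : ℕ) :
    formD (X 1 * invX T a ^ (i + 1)) -
          ((![(pderiv 0 (invX T a ^ (i + 1)) - pderiv 2 (invX T a ^ (i + 1)) * X 2 ^ 2 * pderiv 0 (prodP T)) * X 1, 0, 0] : Fin 3 → MvPolynomial (Fin 3) ℂ) - ((pderiv 0 (invX T a ^ (i + 1)) - pderiv 2 (invX T a ^ (i + 1)) * X 2 ^ 2 * pderiv 0 (prodP T)) * fPoly3 L) • Theta0 L) -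
        ((![0, invX T a ^ (i + 1), 0] : Fin 3 → MvPolynomial (Fin 3) ℂ) - (invX T a ^ (i + 1) * (C (1 / 2) * pderiv 0 (fPoly3 L))) • Theta0 L) -
      (![X 1 * pderiv 2 (invX T a ^ (i + 1)) * X 2 ^ 2 * pderiv 0 (prodP T), 0, X 1 * pderiv 2 (invX T a ^ (i + 1))] : Fin 3 → MvPolynomial (Fin 3) ℂ) =
    ((pderiv 0 (invX T a ^ (i + 1)) - pderiv 2 (invX T a ^ (i + 1)) * X 2 ^ 2 * pderiv 0 (prodP T)) * fPoly3 L + invX T a ^ (i + 1) * (C (1 / 2) * pderiv 0 (fPoly3 L))) • Theta0 L := by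
  have h0 : pderiv 0 (X 1 * invX T a ^ (i + 1)) = X 1 * pderiv 0 (invX T a ^ (i + 1)) := by
    rw [pderiv_mul, pderiv_X_of_ne (by decide), zero_mul, zero_add]
  have h1 : pderiv 1 (X 1 * invX T a ^ (i + 1)) = invX T a ^ (i + 1) := by
    rw [pderiv_mul, pderiv_X_self, one_mul, pderiv_one_invX_pow, mul_zero, add_zero]
  have h2 : pderiv 2 (X 1 * invX T a ^ (i + 1)) = X 1 * pderiv 2 (invX T a ^ (i + 1)) := by
    rw [pderiv_mul, pderiv_X_of_ne (by decide), zero_mul, zero_add]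
  rw [funext_iff, Fin.forall_fin_succ, Fin.forall_fin_two, Fin.succ_zero_eq_one, Fin.succ_one_eq_two]
  simp only [formD, Pi.sub_apply, Pi.smul_apply, smul_eq_mul, Matrix.cons_val_zero,
    Matrix.cons_val_one, Matrix.cons_val_two, Matrix.head_cons, Matrix.tail_cons, h0, h1, h2]
  exact ⟨by ring, by ring, by ring⟩

/-- Hence `(R_{a,i} f + u^{i+1} f′/2) θ₀^C` is reducible (it is `d(y u^{i+1})` up to vanishing forms). [folklore] -/
theorem fred_key (h₂ : IsAlgebraic ℚ L.g₂) (h₃ : IsAlgebraic ℚ L.g₃) (hT : ∀ b ∈ T, IsAlgebraic ℚ b)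
    (a : ℂ) (i : ℕ) :
    FRed[L, T] (((pderiv 0 (invX T a ^ (i + 1)) - pderiv 2 (invX T a ^ (i + 1)) * X 2 ^ 2 * pderiv 0 (prodP T)) *
        fPoly3 L + invX T a ^ (i + 1) * (C (1 / 2) * pderiv 0 (fPoly3 L))) • Theta0 L) := by
  have hu : HasAlgCoeffs (invX T a ^ (i + 1)) := (hasAlgCoeffs_invX hT a).pow _
  have hR : HasAlgCoeffs (pderiv 0 (invX T a ^ (i + 1)) -
      pderiv 2 (invX T a ^ (i + 1)) * X 2 ^ 2 * pderiv 0 (prodP T)) :=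
    (hu.pderiv 0).sub ((((hu.pderiv 2).mul ((hasAlgCoeffs_X 2).pow 2)).mul ((hasAlgCoeffs_prodP hT).pderiv 0)))
  have hQ : HasAlgCoeffs (X 1 * pderiv 2 (invX T a ^ (i + 1))) := (hasAlgCoeffs_X 1).mul (hu.pderiv 2)
  have hf := hasAlgCoeffs_fPoly3 L h₂ h₃
  have hf' : HasAlgCoeffs (C (1 / 2) * pderiv 0 (fPoly3 L)) :=
    (hasAlgCoeffs_C (by rw [one_div]; exact (isAlgebraic_nat 2).inv)).mul (hf.pderiv 0)
  have hΘ := hasAlgCoeffs_Theta0 L h₂ h₃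
  rw [← formD_X_one_mul_invX_pow]
  refine fred_sub (fred_sub (fred_sub (fred_formD ((hasAlgCoeffs_X 1).mul hu)) (fred_vanish ?_ (vanishesOn_rule_a L T _)))
    (fred_vanish ?_ (vanishesOn_rule_b L T _))) (fred_vanish ?_ (vanishesOn_rule_w L T _))
  · exact fun k => (hasAlgCoeffs_vec3 (hR.mul (hasAlgCoeffs_X 1)) hasAlgCoeffs_zero hasAlgCoeffs_zero k).sub
      (hasAlgCoeffs_smul_form (hR.mul hf) hΘ k)
  · exact fun k => (hasAlgCoeffs_vec3 hasAlgCoeffs_zero hu hasAlgCoeffs_zero k).sub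
      (hasAlgCoeffs_smul_form (hu.mul hf') hΘ k)
  · exact hasAlgCoeffs_vec3 ((hQ.mul ((hasAlgCoeffs_X 2).pow 2)).mul ((hasAlgCoeffs_prodP hT).pderiv 0))
      hasAlgCoeffs_zero hQ

/-- `f(a)`, `f′(a)` are algebraic for algebraic `a`. [folklore] -/
theorem isAlgebraic_fa (h₂ : IsAlgebraic ℚ L.g₂) (h₃ : IsAlgebraic ℚ L.g₃) (ha : IsAlgebraic ℚ a) :
    IsAlgebraic ℚ (a ^ 3 + A L * a + B L) ∧ IsAlgebraic ℚ (3 * a ^ 2 + A L) :=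
  ⟨((ha.pow 3).add ((isAlgebraic_A L h₂).mul ha)).add (isAlgebraic_B L h₃),
    ((isAlgebraic_nat 3).mul (ha.pow 2)).add (isAlgebraic_A L h₂)⟩

/-- **Pole lowering, `j = 1`**: `−f(a) u² θ₀ − ½ f′(a) u θ₀ + ½ (x − a) θ₀` is reducible (`≡ d(y u)`). [folklore] -/
theorem fred_pole_one (h₂ : IsAlgebraic ℚ L.g₂) (h₃ : IsAlgebraic ℚ L.g₃) (hT : ∀ b ∈ T, IsAlgebraic ℚ b)
    (ha : a ∈ T) :
    FRed[L, T] ((C (-(a ^ 3 + A L * a + B L)) * invX T a ^ 2 + C (-((3 * a ^ 2 + A L) / 2)) * invX T a +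
      C (1 / 2) * (X 0 - C a)) • Theta0 L) := by
  have hu : HasAlgCoeffs (invX T a) := hasAlgCoeffs_invX hT a
  obtain ⟨hfa, hf'a⟩ := isAlgebraic_fa (L := L) h₂ h₃ (hT a ha)
  have hhalf : IsAlgebraic ℚ ((1 : ℂ) / 2) := by rw [one_div]; exact (isAlgebraic_nat 2).inv
  refine fred_smul_Theta0_congr h₂ h₃ ?_ ?_ (fun p hp => ?_) (fred_key h₂ h₃ hT a 0)
  · exact ((((hasAlgCoeffs_C hfa.neg).mul (hu.pow 2)).add ((hasAlgCoeffs_C (by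
      rw [div_eq_mul_inv]; exact (hf'a.mul (isAlgebraic_nat 2).inv).neg)).mul hu)).add
      ((hasAlgCoeffs_C hhalf).mul ((hasAlgCoeffs_X 0).sub (hasAlgCoeffs_C (hT a ha)))))
  · exact (((((hu.pow 1).pderiv 0).sub ((((hu.pow 1).pderiv 2).mul ((hasAlgCoeffs_X 2).pow 2)).mul
      ((hasAlgCoeffs_prodP hT).pderiv 0))).mul (hasAlgCoeffs_fPoly3 L h₂ h₃)).add ((hu.pow 1).mul
      ((hasAlgCoeffs_C hhalf).mul ((hasAlgCoeffs_fPoly3 L h₂ h₃).pderiv 0))))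
  · have hV := eval_invX_mul_sub ha hp
    symm
    rw [map_add, map_mul, eval_Rpol ha hp 0]
    simp only [map_add, map_mul, map_sub, map_pow, eval_C, eval_X, eval_fPoly3, eval_pderiv_zero_fPoly3,
      Nat.cast_zero, zero_add, pow_one]
    linear_combination (-((3 * a ^ 2 + A L) * eval p (invX T a)) - 3 * a * eval p (invX T a) * (p 0 - a) -
      eval p (invX T a) * (p 0 - a) ^ 2 + (p 0 - a) / 2) * hV

/-- **Pole lowering, `j = i + 2`**: `−j f(a) u^{j+1} θ₀ + (½ − j) f′(a) u^j θ₀ − 3a(j − 1) u^{j−1} θ₀ − (j − 3/2) u^{j−2} θ₀`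
is reducible (`≡ d(y u^j)`; Taylor expansion of `f`, `f′` at `a`). [folklore] -/
theorem fred_pole_succ (h₂ : IsAlgebraic ℚ L.g₂) (h₃ : IsAlgebraic ℚ L.g₃) (hT : ∀ b ∈ T, IsAlgebraic ℚ b)
    (ha : a ∈ T) (i : ℕ) :
    FRed[L, T] ((C (-(((i : ℂ) + 2) * (a ^ 3 + A L * a + B L))) * invX T a ^ (i + 3) +
      C ((1 / 2 - ((i : ℂ) + 2)) * (3 * a ^ 2 + A L)) * invX T a ^ (i + 2) +
      C (-(3 * a * ((i : ℂ) + 1))) * invX T a ^ (i + 1) + C (-((i : ℂ) + 1 / 2)) * invX T a ^ i) • Theta0 L) := by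
  have hu : HasAlgCoeffs (invX T a) := hasAlgCoeffs_invX hT a
  obtain ⟨hfa, hf'a⟩ := isAlgebraic_fa (L := L) h₂ h₃ (hT a ha)
  have hhalf : IsAlgebraic ℚ ((1 : ℂ) / 2) := by rw [one_div]; exact (isAlgebraic_nat 2).inv
  have hi2 : IsAlgebraic ℚ ((i : ℂ) + 2) := (isAlgebraic_nat i).add (isAlgebraic_nat 2)
  have hi1 : IsAlgebraic ℚ ((i : ℂ) + 1) := (isAlgebraic_nat i).add isAlgebraic_one
  refine fred_smul_Theta0_congr h₂ h₃ ?_ ?_ (fun p hp => ?_) (fred_key h₂ h₃ hT a (i + 1))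
  · exact (((((hasAlgCoeffs_C (hi2.mul hfa).neg).mul (hu.pow _)).add ((hasAlgCoeffs_C ((hhalf.sub hi2).mul
      hf'a)).mul (hu.pow _))).add ((hasAlgCoeffs_C (((isAlgebraic_nat 3).mul (hT a ha)).mul hi1).neg).mul
      (hu.pow _))).add ((hasAlgCoeffs_C ((isAlgebraic_nat i).add hhalf).neg).mul (hu.pow _)))
  · exact (((((hu.pow _).pderiv 0).sub ((((hu.pow _).pderiv 2).mul ((hasAlgCoeffs_X 2).pow 2)).mul
      ((hasAlgCoeffs_prodP hT).pderiv 0))).mul (hasAlgCoeffs_fPoly3 L h₂ h₃)).add ((hu.pow _).mul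
      ((hasAlgCoeffs_C hhalf).mul ((hasAlgCoeffs_fPoly3 L h₂ h₃).pderiv 0))))
  · have hV := eval_invX_mul_sub ha hp
    symm
    rw [map_add, map_mul, eval_Rpol ha hp (i + 1)]
    simp only [map_add, map_mul, map_pow, eval_C, eval_fPoly3, eval_pderiv_zero_fPoly3,
      Nat.cast_add, Nat.cast_one]
    linear_combination (eval p (invX T a) ^ i * (-((i : ℂ) + 2) * (3 * a ^ 2 + A L) * eval p (invX T a) ^ 2 +
      (3 * a - 6 * a * ((i : ℂ) + 2)) * eval p (invX T a) + (3 - 3 * ((i : ℂ) + 2)) +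
      (eval p (invX T a) * (p 0 - a) - 1) * (-3 * a * ((i : ℂ) + 2) * eval p (invX T a) - 3 * ((i : ℂ) + 2) + 3 / 2) -
      ((i : ℂ) + 2) * (eval p (invX T a) * (p 0 - a) - 1) ^ 2)) * hV

/-- `2`-torsion abscissae `a` (`f(a) = 0`) have `f′(a) ≠ 0`. [folklore] -/
theorem fderiv_ne_zero_of_fa_eq_zero (ha0 : a ^ 3 + A L * a + B L = 0) : 3 * a ^ 2 + A L ≠ 0 :=
  fderiv_ne_zero_of_y_eq_zero L (q := ![a, 0, 0]) (by simpa using ha0.symm) rfl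

/-- **`u^m θ₀^C` is reducible for every `m`** (`u = 1/(x − a)`, `a ∈ T`): `θ₀`, `ξ_a`, and strong induction by pole
lowering (dividing by `−j f(a)` if `f(a) ≠ 0`, else by `(½ − j) f′(a) ≠ 0`). [cite: HuberWustholz2022, §13.2] -/
theorem fred_invX_pow_smul_Theta0 : ∀ (L : PeriodPair) (T : Finset ℂ), IsAlgebraic ℚ L.g₂ → IsAlgebraic ℚ L.g₃ → (∀ b ∈ T, IsAlgebraic ℚ b) → ∀ (c : ℂ), c ∈ T → ∀ (m : ℕ), ∃ (a b : ℂ) (e o : ℂ → ℂ) (F : MvPolynomial (Fin 3) ℂ) (ν : Fin 3 → MvPolynomial (Fin 3) ℂ), IsAlgebraic ℚ a ∧ IsAlgebraic ℚ b ∧ (∀ t ∈ T, IsAlgebraic ℚ (e t)) ∧ (∀ t ∈ T, IsAlgebraic ℚ (o t)) ∧ HasAlgCoeffs F ∧ (∀ i, HasAlgCoeffs (ν i)) ∧ VanishesOn (curveP L T) ν ∧ invX T c ^ m • Theta0 L = a • Theta0 L + b • Theta1 L + ∑ t ∈ T, e t • dlogV T t + ∑ t ∈ T, o t • Xi L T t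 + formD F + ν := by
  intro L T h₂ h₃ hT a ha
  obtain ⟨hfa, hf'a⟩ := isAlgebraic_fa (L := L) h₂ h₃ (hT a ha)
  have hhalf : IsAlgebraic ℚ ((1 : ℂ) / 2) := by rw [one_div]; exact (isAlgebraic_nat 2).inv
  intro m
  induction m using Nat.strong_induction_on with
  | _ m ih =>
    rcases m with _ | m
    · simpa using (fred_Theta0 (L := L) (T := T))
    rcases m with _ | m
    · rw [pow_one]
      exact fred_Xi ha
    -- `m + 2`
    by_cases hfa0 : a ^ 3 + A L * a + B L = 0
    · -- `f(a) = 0`: identity `j = m + 2`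
      have hk := fred_pole_succ h₂ h₃ hT ha m
      rw [hfa0, mul_zero, neg_zero, C_0, zero_mul, zero_add, add_smul, add_smul, C_mul_smul_form,
        C_mul_smul_form, C_mul_smul_form] at hk
      have hne : (1 / 2 - ((m : ℂ) + 2)) * (3 * a ^ 2 + A L) ≠ 0 := by
        refine mul_ne_zero ?_ (fderiv_ne_zero_of_fa_eq_zero hfa0)
        intro h
        have : ((2 * m + 3 : ℕ) : ℂ) = 0 := by push_cast; linear_combination -2 * h
        exact Nat.cast_ne_zero.2 (by omega) this
      have hm1 : (m : ℂ) + 2 = ((m + 2 : ℕ) : ℂ) := by push_cast; ring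
      refine fred_of_smul ((hhalf.sub ((isAlgebraic_nat m).add (isAlgebraic_nat 2))).mul hf'a) hne ?_
      have h := fred_sub (fred_sub hk
        (fred_smul (c := -((m : ℂ) + 1 / 2)) ((isAlgebraic_nat m).add hhalf).neg (ih m (by omega))))
        (fred_smul (c := -(3 * a * ((m : ℂ) + 1)))
          (((isAlgebraic_nat 3).mul (hT a ha)).mul ((isAlgebraic_nat m).add isAlgebraic_one)).neg
          (ih (m + 1) (by omega)))
      rwa [add_sub_cancel_right, add_sub_cancel_right] at h
    · rcases m with _ | i
      · -- `j = 1`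
        have hk := fred_pole_one h₂ h₃ hT ha
        rw [add_smul, add_smul, C_mul_smul_form, C_mul_smul_form, C_mul_smul_form] at hk
        refine fred_of_smul hfa.neg (neg_ne_zero.2 hfa0) ?_
        have h1 : FRed[L, T] (invX T a • Theta0 L) := by simpa using ih 1 (by omega)
        have h := fred_sub (fred_sub hk
          (fred_smul (c := (1 / 2 : ℂ)) hhalf (fred_X_sub_C_smul_Theta0 h₂ h₃ (hT a ha))))
          (fred_smul (c := -((3 * a ^ 2 + A L) / 2)) (by
            rw [div_eq_mul_inv]; exact (hf'a.mul (isAlgebraic_nat 2).inv).neg) h1)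
        rwa [add_sub_cancel_right, add_sub_cancel_right] at h
      · -- `j = i + 2`
        have hk := fred_pole_succ h₂ h₃ hT ha i
        rw [add_smul, add_smul, add_smul, C_mul_smul_form, C_mul_smul_form, C_mul_smul_form,
          C_mul_smul_form] at hk
        have hne : -(((i : ℂ) + 2) * (a ^ 3 + A L * a + B L)) ≠ 0 := by
          refine neg_ne_zero.2 (mul_ne_zero ?_ hfa0)
          exact_mod_cast Nat.succ_ne_zero (i + 1)
        refine fred_of_smul (((isAlgebraic_nat i).add (isAlgebraic_nat 2)).mul hfa).neg hne ?_
        have h := fred_sub (fred_sub (fred_sub hk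
          (fred_smul (c := -((i : ℂ) + 1 / 2)) ((isAlgebraic_nat i).add hhalf).neg (ih i (by omega))))
          (fred_smul (c := -(3 * a * ((i : ℂ) + 1)))
            (((isAlgebraic_nat 3).mul (hT a ha)).mul ((isAlgebraic_nat i).add isAlgebraic_one)).neg
            (ih (i + 1) (by omega))))
          (fred_smul (c := (1 / 2 - ((i : ℂ) + 2)) * (3 * a ^ 2 + A L))
            ((hhalf.sub ((isAlgebraic_nat i).add (isAlgebraic_nat 2))).mul hf'a) (ih (i + 2) (by omega)))
        rwa [add_sub_cancel_right, add_sub_cancel_right, add_sub_cancel_right] at h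

/-- **`u^m dx` is reducible** (`u = 1/(x − a)`, `a ∈ T`): `dx` is exact, `u dx = dlogV`, and
`d(u^{i+1}) ≡ −(i+1) u^{i+2} dx`. [folklore] -/
theorem fred_invX_pow_dx (h₂ : IsAlgebraic ℚ L.g₂) (h₃ : IsAlgebraic ℚ L.g₃) (hT : ∀ b ∈ T, IsAlgebraic ℚ b)
    (ha : a ∈ T) : ∀ m : ℕ, FRed[L, T] (![invX T a ^ m, 0, 0] : Fin 3 → MvPolynomial (Fin 3) ℂ)
  | 0 => by simpa using fred_X_pow_dx (L := L) (T := T) h₂ h₃ 0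
  | 1 => by
    rw [pow_one]
    exact fred_dlogV ha
  | i + 2 => by
    have hu : HasAlgCoeffs (invX T a) := hasAlgCoeffs_invX hT a
    have hQ : HasAlgCoeffs (pderiv 2 (invX T a ^ (i + 1))) := (hu.pow _).pderiv 2
    have hR : HasAlgCoeffs (pderiv 0 (invX T a ^ (i + 1)) -
        pderiv 2 (invX T a ^ (i + 1)) * X 2 ^ 2 * pderiv 0 (prodP T)) :=
      ((hu.pow _).pderiv 0).sub (((hQ.mul ((hasAlgCoeffs_X 2).pow 2)).mul ((hasAlgCoeffs_prodP hT).pderiv 0)))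
    have h1 : FRed[L, T] (![pderiv 0 (invX T a ^ (i + 1)) -
        pderiv 2 (invX T a ^ (i + 1)) * X 2 ^ 2 * pderiv 0 (prodP T), 0, 0] : Fin 3 → MvPolynomial (Fin 3) ℂ) := by
      have e : (![pderiv 0 (invX T a ^ (i + 1)) -
          pderiv 2 (invX T a ^ (i + 1)) * X 2 ^ 2 * pderiv 0 (prodP T), 0, 0] : Fin 3 → MvPolynomial (Fin 3) ℂ) =
          formD (invX T a ^ (i + 1)) - ![pderiv 2 (invX T a ^ (i + 1)) * X 2 ^ 2 * pderiv 0 (prodP T), 0,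
            pderiv 2 (invX T a ^ (i + 1))] := by
        rw [formD_invX_pow, add_sub_cancel_right]
      rw [e]
      exact fred_sub (fred_formD (hu.pow _)) (fred_vanish (hasAlgCoeffs_vec3 ((hQ.mul ((hasAlgCoeffs_X 2).pow
        2)).mul ((hasAlgCoeffs_prodP hT).pderiv 0)) hasAlgCoeffs_zero hQ) (vanishesOn_rule_w L T _))
    have hi1 : IsAlgebraic ℚ (-((i : ℂ) + 1)) := ((isAlgebraic_nat i).add isAlgebraic_one).neg
    have h2 : FRed[L, T] (![C (-((i : ℂ) + 1)) * invX T a ^ (i + 2), 0, 0] : Fin 3 → MvPolynomial (Fin 3) ℂ) :=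
      fred_dx_congr ((hasAlgCoeffs_C hi1).mul (hu.pow _)) hR
        (fun p hp => by rw [eval_Rpol ha hp i]; simp) h1
    have e2 : (![C (-((i : ℂ) + 1)) * invX T a ^ (i + 2), 0, 0] : Fin 3 → MvPolynomial (Fin 3) ℂ) =
        (-((i : ℂ) + 1)) • (![invX T a ^ (i + 2), 0, 0] : Fin 3 → MvPolynomial (Fin 3) ℂ) := by
      funext k
      fin_cases k <;> simp [smul_eq_C_mul]
    rw [e2] at h2
    exact fred_of_smul hi1 (neg_ne_zero.2 (Nat.cast_add_one_ne_zero i)) h2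

end Pole


end TorsionLayer

end Summit.KontsevichZagierPeriods.SymplecticScissors.RealOnePeriodRelations

end
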